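import Summits.Ventures.PercRepro.C041SkeletonPortB

/-!
# THEOREM R, the reduction: the red-type dictionary — with the terminal edge, «red type `D`» is `X₁ ∨ X₂` (p6, gen 23)

Setting of `C041SkeletonPort` (mine-3, C-041.md §3: «when `12 ∈ E` (all its copies red in every source) red type `D` is
`X₁ ∨ X₂`»).  With a red edge between the terminals, `c` is red-joined to both terminals iff it is red-joined to one,
iff some port carries a red terminal edge: a red walk from `c` to a terminal, cut at its first terminal, is a red BARE walk
to a port followed by a red terminal edge (`red_iff_X`).  Together with `good_a_iff` / `good_b_iff` this is the red half
of the validity dictionary of §6 (d); the blue half (type `A` ⟺ admissibility and the outside constraints) and the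
count remain (proofs/P6-THEOREM-R-LEAN-PLAN.md §6).
-/

namespace PercRepro

namespace MultiGraph

open Finset PortProblem

variable {V E : Type*} {G : MultiGraph V E}

section Red

variable [Fintype V] {a b c : V} (hc : ∀ e, ¬ G.Joins e c a ∧ ¬ G.Joins e c b) {S : Config E}

omit [Fintype V] in
/-- A red bare walk is a red connection. -/
theorem conn_of_bareReach {u : V} (hu : u ∈ G.BareReach a b c S) : G.Conn S c u :=
  reflTransGen_mono' (fun _ _ h => h.openAdj) hu

open Classical in
/-- **A red terminal edge at a port joins `c` to that terminal.** -/
theorem conn_of_X₁ (hx : (G.portOf a b c hc S).X₁ (G.patternOf a b c hc S)) : G.Conn S c a := by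
  obtain ⟨t, ht2, hxt⟩ := hx
  have hu : t.1.1 ∈ (G.portOf a b c hc S).M := t.2.1
  have hk : (G.portOf a b c hc S).k₁ t.1.1 = true := t.2.2.1 ht2
  have hteq : t = ⟨(t.1.1, false), hu, fun _ => hk, fun h => Bool.noConfusion h⟩ :=
    Subtype.ext (Prod.ext_iff.mpr ⟨rfl, ht2⟩)
  rw [hteq, patternOf_one hc hu hk] at hxt
  obtain ⟨e, hje, hSe⟩ := decide_eq_true_iff.1 hxt
  exact (conn_of_bareReach ((mem_portM hc).1 hu).1).trans (Conn.of_openAdj ⟨e, hSe, hje⟩)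

open Classical in
/-- **A red terminal edge at a port joins `c` to that terminal.** -/
theorem conn_of_X₂ (hx : (G.portOf a b c hc S).X₂ (G.patternOf a b c hc S)) : G.Conn S c b := by
  obtain ⟨t, ht2, hxt⟩ := hx
  have hu : t.1.1 ∈ (G.portOf a b c hc S).M := t.2.1
  have hk : (G.portOf a b c hc S).k₂ t.1.1 = true := t.2.2.2 ht2
  have hteq : t = ⟨(t.1.1, true), hu, fun h => Bool.noConfusion h, fun _ => hk⟩ :=
    Subtype.ext (Prod.ext_iff.mpr ⟨rfl, ht2⟩)
  rw [hteq, patternOf_two hc hu hk] at hxt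
  obtain ⟨e, hje, hSe⟩ := decide_eq_true_iff.1 hxt
  exact (conn_of_bareReach ((mem_portM hc).1 hu).1).trans (Conn.of_openAdj ⟨e, hSe, hje⟩)

open Classical in
/-- **A red connection from `c` to a terminal gives a red terminal edge at a port**: cut the walk at its first
terminal. -/
theorem X_of_conn (hca : c ≠ a) (hcb : c ≠ b) (h : G.Conn S c a ∨ G.Conn S c b) :
    (G.portOf a b c hc S).X₁ (G.patternOf a b c hc S) ∨ (G.portOf a b c hc S).X₂ (G.patternOf a b c hc S) := by
  -- the first terminal on the walk
  have hfirst : ∃ t ∈ ({a, b} : Set V),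
      Relation.ReflTransGen (fun x y => G.OpenAdj S x y ∧ x ∉ ({a, b} : Set V)) c t := by
    rcases h with h | h
    · exact exists_first_mem_of_conn h (by simp)
    · exact exists_first_mem_of_conn h (by simp)
  obtain ⟨t, ht, hwalk⟩ := hfirst
  have hct : c ≠ t := by
    rintro rfl
    simp only [Set.mem_insert_iff, Set.mem_singleton_iff] at ht
    rcases ht with h | h
    · exact hca h
    · exact hcb h
  obtain ⟨w, ⟨hwt, hwY⟩, hcw⟩ := exists_last_step hwalk hct
  -- the prefix is a red bare walk
  have key : ∀ v, Relation.ReflTransGen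
      (fun x y => (G.OpenAdj S x y ∧ x ∉ ({a, b} : Set V)) ∧ y ≠ t) c v →
      v ∉ ({a, b} : Set V) → v ∈ G.BareReach a b c S := by
    intro v hv
    induction hv with
    | refl => intro _; exact Relation.ReflTransGen.refl
    | @tail x y hcx hxy ih =>
      intro hy
      have hx : x ∉ ({a, b} : Set V) := hxy.1.2
      have hx' : x ≠ a ∧ x ≠ b := by
        simp only [Set.mem_insert_iff, Set.mem_singleton_iff, not_or] at hx
        exact hx
      have hy' : y ≠ a ∧ y ≠ b := by
        simp only [Set.mem_insert_iff, Set.mem_singleton_iff, not_or] at hy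
        exact hy
      exact (ih hx).tail (bareAdj_of_openAdj hxy.1.1 hx' hy')
  have hwK : w ∈ G.BareReach a b c S := key w hcw hwY
  obtain ⟨e, hSe, hje⟩ := hwt
  simp only [Set.mem_insert_iff, Set.mem_singleton_iff] at ht
  rcases ht with rfl | rfl
  · -- `t = a`
    have hwM : w ∈ (G.portOf t b c hc S).M := (mem_portM hc).2 ⟨hwK, e, Or.inl hje⟩
    have hk : (G.portOf t b c hc S).k₁ w = true := decide_eq_true_iff.2 ⟨e, hje⟩
    left
    refine ⟨⟨(w, false), hwM, fun _ => hk, fun h => Bool.noConfusion h⟩, rfl, ?_⟩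
    rw [patternOf_one hc hwM hk]
    exact decide_eq_true_iff.2 ⟨e, hje, hSe⟩
  · -- `t = b`
    have hwM : w ∈ (G.portOf a t c hc S).M := (mem_portM hc).2 ⟨hwK, e, Or.inr hje⟩
    have hk : (G.portOf a t c hc S).k₂ w = true := decide_eq_true_iff.2 ⟨e, hje⟩
    right
    refine ⟨⟨(w, true), hwM, fun h => Bool.noConfusion h, fun _ => hk⟩, rfl, ?_⟩
    rw [patternOf_two hc hwM hk]
    exact decide_eq_true_iff.2 ⟨e, hje, hSe⟩

open Classical in
/-- **The red-type dictionary with the terminal edge**: if some edge between the terminals is red, `c` is red-joined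
to both terminals iff some port carries a red terminal edge (`X₁ ∨ X₂`). -/
theorem red_iff_X (hca : c ≠ a) (hcb : c ≠ b) (hab : ∃ e, G.Joins e a b ∧ S e = true) :
    (G.Conn S c a ∧ G.Conn S c b) ↔
      ((G.portOf a b c hc S).X₁ (G.patternOf a b c hc S) ∨
        (G.portOf a b c hc S).X₂ (G.patternOf a b c hc S)) := by
  obtain ⟨e₀, hj₀, hS₀⟩ := hab
  have hab' : G.Conn S a b := Conn.of_openAdj ⟨e₀, hS₀, hj₀⟩
  constructor
  · intro h
    exact X_of_conn hc hca hcb (Or.inl h.1)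
  · rintro (h | h)
    · have := conn_of_X₁ hc h
      exact ⟨this, this.trans hab'⟩
    · have := conn_of_X₂ hc h
      exact ⟨this.trans hab'.symm, this⟩

end Red

end MultiGraph

end PercRepro
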